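import Summits.BirchSwinnertonDyer.BirchSwinnertonDyer.Theorems.PrintCf2SplitBadTwoXRegularPinnedOfChar
import Summits.BirchSwinnertonDyer.BirchSwinnertonDyer.Theorems.PrintCf2SplitBadTwoNormAtVbarTotallyRamified
import Summits.BirchSwinnertonDyer.BirchSwinnertonDyer.Theorems.PrintCf2SplitBadTwoQuadraticSignCharacter
import Summits.BirchSwinnertonDyer.BirchSwinnertonDyer.Theorems.PrintCf2RubinValueTwoLinePinClassJunctionXRegular
import HarnessLib

/-!
# Crux `PrintCf2.SplitBadTwoRankOneOfFacts` (stmt-BirchSwinnertonDyer-20368), registered stub (REG₂) `stub_xRegular_two` (= route-C 24246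
# `XRegularAtTwo`) and M-LINE-PIN stub (R) `stub_xRegularInner`: THE CASE ANALYSIS OF THE CLOSER OUTSIDE «B5-T» —
# (a) a sign non-trivial on `U ⊓ D_v̄` is so above every `w′ ∣ v̄`; (c) ⟹ (b): a sign trivial on `U_m ⊓ D_v̄` but not on `D_v̄` IS the
# quadratic character of the line on `D_v̄`, and the re-twist `θ ⊗ χ_κ` agrees with `θ` on `U_m` and has sign trivial on `D_v̄`

Cell `bsd-print-cf2`, WIDTH seat `bsd-line-cf2-p1-w2` g15 (prover-bsd-line-cf2-p1-w2-g15-0); `--supports stmt-BirchSwinnertonDyer-20368`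
(helper, Theses-free). HONEST FRAMING: nothing here closes the crux or a registered stub; these are the group-theoretic / prime-ideal
lemmas that the by-name closers of (REG₂) (over the `v̄`-line `κ₂`) and of (R) (over the `v`-line `κ₁` of a DA7 frame) apply OUTSIDE the
twisted `v̄`-reading «B5-T» (-w8 g5 p710454 `locSurj_layers_twisted` displays it; -w4 g14 discharges its case (B1) `ε|_{D_v̄} = 1`).
BSD is not proved by any of this; no summit statement is proved by this seat. No definition, no named fact, no `sorry`.

THE CASE ANALYSIS (STATUS 2026-08-29T07:56:35Z -w4 g14, 09:02:36Z -w8 g5, 09:04:24Z this seat). `θ` quadratic framed character with sign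
`ε : Γ_K →* ℤˣ` (`ε σ = 1 ↔ unitChar θ σ = 1`, p706294), `U = U_m = κ.layerSubgroup m` (`m ≥ 1`), `D_v̄ = decomp v̄` (the chosen prime `𝔓₀`):
* (a) `ε ≢ 1` on `U ⊓ D_v̄` ⟹ **`forall_exists_stabilizer_sign_ne_one`**: above EVERY place `w′ ∣ v̄` of `F′` there is a prime `𝔓 = g • 𝔓₀`
  stabilised by some `s = g s₀ g⁻¹ ∈ U` with `ε s ≠ 1` — the right disjunct of the displayed `v̄`-reading of p705557 / p706910 / p710454, so
  «B5-T» is discharged for free in this case;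
* (b) `ε|_{D_v̄} = 1` ⟹ -w4 g14's twisted Kummer reading (p709686 / p710167 / assembly) gives the left disjunct;
* (c) `ε = 1` on `U ⊓ D_v̄`, `ε ≢ 1` on `D_v̄` ⟹ **`sign_eq_one_iff_signChar_eq_one_on_decomp_of_mem`**: `ε` and the quadratic character `χ_κ`
  of the line (-w2 g14 `XRegPinned.exists_signChar`) have the same kernel on `D_v̄`, PROVIDED `v̄` is undecomposed in `K_m` (`∃ τ ∈ D_v̄`,
  `τ⁻¹γ ∈ U_m`: then `Γ_K/U_m = ⟨γ⟩` is cyclic, `D_v̄ ⊆ ⋃ⱼ τ^j U_m`, and both characters are the unique order-two character of `D_v̄/(D_v̄ ⊓ U_m)` —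
  **`apply_eq_one_iff_of_cyclic_mod`**); hence **`exists_retwist_agree_on_layer_sign_trivial_on_decomp`**: `θ₀ := θ ⊗ χ_κ`
  (**`exists_twist_by_signChar`**) is quadratic, agrees with `θ` on `U_m` and on `ker κ` (`χ_κ|_{U₁} = 1`, **`apply_eq_one_of_mem_layerSubgroup_one`**),
  and its sign is trivial on `D_v̄` — case (b) for `θ₀`; -w4 g14's `SignTwist.locSurj_charModule_of_unitChar_eq_on θ₀ θ U_m` (p708344) carries
  (LS_m) back from `A_{θ₀}` to `A_θ`.
The undecomposedness input: on the `v̄`-LINE (`κ₂` unramified outside `v̄`, odd class number) `v̄` is totally ramified — -w3 g14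
`NormAtVbar.forall_exists_inertia_mul_mem_galFixing_layer` (**`sign_eq_one_iff_signChar_eq_one_on_decomp`**); on the `v`-LINE of a DA7 frame
(`disc K = −7`, `κ₁` unramified outside `v`) cf2c-w8 g4 `LinePin.exists_mem_decomp_vbar_apply_eq_of_discr` (**`…_vLine`**). Also:
**`exists_pow_inv_mul_mem_layerSubgroup`** (`Γ_K = ⋃ⱼ γ^j U_n`, `j = appr_n κ(σ)`).
presearch: «quadratic character of a Z_p-extension, decomposition group cyclic quotient, twist by character trivial on subgroup» —
[GreenbergLNM1716] §4 p. 107 (`A_s = A ⊗ κ^s` over `F_∞`), [Washington1997] §13.1; elementary group theory, no new fact. beyond-print theorem: no.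

References: [Washington1997] §13.1; [NeukirchANT1999] Ch. I §9 (9.1)–(9.6), Ch. II §9 (9.6); [GreenbergLNM1716] §4 p. 107; [KellerYin2024] §1.1.
-/

noncomputable section

set_option linter.dupNamespace false
set_option autoImplicit false

open scoped Classical Pointwise
open NumberField IsDedekindDomain Field
open Literature.NumberTheory.EllipticCurves Literature.NumberTheory.EllipticCurves.GreenbergSelmer
open Literature.NumberTheory.EllipticCurves.KellerYin2024
open Literature.NumberTheory.GaloisRepresentations Literature.NumberTheory.GaloisRepresentations.LocalWeilDatum

namespace Summit.BirchSwinnertonDyer.BirchSwinnertonDyer.Theorems.PrintCf2.XRegClose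

/-! ## §1. Group theory: two sign characters on a subgroup that is cyclic modulo `U` -/

/-- In a monoid, an element `g ≠ 1` with `g ^ 2 = 1` satisfies `g ^ j = 1 ↔ 2 ∣ j`. [folklore] -/
theorem pow_eq_one_iff_two_dvd_of_sq {M : Type*} [Monoid M] {g : M} (h1 : g ≠ 1) (h2 : g ^ 2 = 1) (j : ℕ) :
    g ^ j = 1 ↔ 2 ∣ j := by
  have ho : orderOf g = 2 := orderOf_eq_prime h2 h1
  rw [← ho]
  exact (orderOf_dvd_iff_pow_eq_one).symm

/-- **Two `{±1}`-valued characters agree (as to triviality) on a subgroup `D` that is cyclic modulo `U`.** `G` a group, `U, D ≤ G`,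
`τ ∈ D` with `D ⊆ ⋃ⱼ τ^j U`; `ε : G →* ℤˣ` trivial on `U ⊓ D` and non-trivial somewhere on `D`; `χ : G →* M` (any monoid) trivial on `U`
with `χ τ ≠ 1`, `χ τ ^ 2 = 1`. Then `ε σ = 1 ↔ χ σ = 1` for every `σ ∈ D`. [folklore] -/
theorem apply_eq_one_iff_of_cyclic_mod {G : Type*} [Group G] {M : Type*} [Monoid M] (U D : Subgroup G) {τ : G} (hτ : τ ∈ D)
    (hgen : ∀ σ ∈ D, ∃ j : ℕ, (τ ^ j)⁻¹ * σ ∈ U) (ε : G →* ℤˣ) (hεU : ∀ u ∈ U, u ∈ D → ε u = 1)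
    (hε : ∃ σ ∈ D, ε σ ≠ 1) (χ : G →* M) (hχU : ∀ u ∈ U, χ u = 1) (hχτ : χ τ ≠ 1) (hχτ2 : χ (τ ^ 2) = 1) :
    ∀ σ ∈ D, ε σ = 1 ↔ χ σ = 1 := by
  -- every `σ ∈ D` is `τ^j u` with `u ∈ U ⊓ D`
  have hdec : ∀ σ ∈ D, ∃ j : ℕ, ε σ = ε (τ ^ j) ∧ χ σ = χ (τ ^ j) := by
    intro σ hσ
    obtain ⟨j, hj⟩ := hgen σ hσ
    have huD : (τ ^ j)⁻¹ * σ ∈ D := D.mul_mem (D.inv_mem (D.pow_mem hτ j)) hσ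
    have hσeq : σ = τ ^ j * ((τ ^ j)⁻¹ * σ) := by group
    refine ⟨j, ?_, ?_⟩
    · conv_lhs => rw [hσeq, map_mul, hεU _ hj huD, mul_one]
    · conv_lhs => rw [hσeq, map_mul, hχU _ hj, mul_one]
  -- `ε τ ≠ 1`
  have hετ : ε τ ≠ 1 := by
    intro h1
    obtain ⟨σ, hσ, hne⟩ := hε
    obtain ⟨j, hj, -⟩ := hdec σ hσ
    exact hne (by rw [hj, map_pow, h1, one_pow])
  intro σ hσ
  obtain ⟨j, hj, hj'⟩ := hdec σ hσ
  rw [hj, hj', map_pow, map_pow, pow_eq_one_iff_two_dvd_of_sq hετ (Int.units_sq _),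
    pow_eq_one_iff_two_dvd_of_sq hχτ (by rw [← map_pow, hχτ2])]

/-! ## §2. Layers of a `ℤ_p`-line: `Γ_K / U_n` is cyclic, generated by a topological generator -/

variable {K : Type} [Field K] [NumberField K] {p : ℕ} [Fact p.Prime]

omit [NumberField K] in
/-- **`Γ_K = ⋃ⱼ γ^j · U_n`** for a topological generator `γ` of the `ℤ_p`-line `κ` and its `n`-th layer group `U_n = κ.layerSubgroup n`:
`κ(γ^{-j} σ) = κ(σ) − j ∈ p^n ℤ_p` for `j := appr (κ σ) n`. [cite: Washington1997, §13.1] -/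
theorem exists_pow_inv_mul_mem_layerSubgroup (κ : ZpExtension K p) {γ : absoluteGaloisGroup K} (hγ : κ.IsTopGenerator γ) (n : ℕ)
    (σ : absoluteGaloisGroup K) : ∃ j : ℕ, (γ ^ j)⁻¹ * σ ∈ κ.layerSubgroup n := by
  refine ⟨((κ σ).toAdd).appr n, ?_⟩
  rw [ZpExtension.mem_layerSubgroup, map_mul, map_inv, map_pow, hγ, toAdd_mul, toAdd_inv, toAdd_pow, toAdd_ofAdd]
  have h := PadicInt.appr_spec n (κ σ).toAdd
  rw [Ideal.mem_span_singleton] at h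
  rwa [nsmul_one, neg_add_eq_sub]

omit [NumberField K] in
/-- **A `{±1}`-valued character trivial on `ker κ` is trivial on the FIRST layer group** (hence on every `U_n`, `n ≥ 1`): `σ ∈ U₁` has
`κ σ = 2b = κ(τ²)` for some `τ` (`κ` is onto), so `σ = τ² k` with `k ∈ ker κ` and `χ σ = χ(τ)² = 1`. For `p = 2`. [cite: Washington1997, §13.1] -/
theorem apply_eq_one_of_mem_layerSubgroup_one {M : Type*} [CommGroup M] (κ : ZpExtension K 2) (χ : absoluteGaloisGroup K →* M)
    (hχ2 : ∀ σ, χ σ ^ 2 = 1) (hker : ∀ σ, κ σ = 1 → χ σ = 1) {σ : absoluteGaloisGroup K} (hσ : σ ∈ κ.layerSubgroup 1) :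
    χ σ = 1 := by
  rw [ZpExtension.mem_layerSubgroup, pow_one] at hσ
  obtain ⟨b, hb⟩ := hσ
  obtain ⟨τ, hτ⟩ := κ.surjective (Multiplicative.ofAdd b)
  have hτ' : κ τ = Multiplicative.ofAdd b := hτ
  have hk : κ ((τ ^ 2)⁻¹ * σ) = 1 := by
    apply Multiplicative.toAdd.injective
    rw [map_mul, map_inv, map_pow, hτ', toAdd_mul, toAdd_inv, toAdd_pow, toAdd_ofAdd, toAdd_one, hb]
    ring
  have hσeq : σ = τ ^ 2 * ((τ ^ 2)⁻¹ * σ) := by group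
  rw [hσeq, map_mul, map_pow, hker _ hk, hχ2, one_mul]


/-! ## §3. On the `v̄`-line: the sign of `θ` on `D_v̄` is the quadratic character of the line (case (B2) → (B1)) -/

/-- `-1 ≠ 1` in `ℤ₂ˣ`. [folklore] -/
theorem neg_one_ne_one_padicIntUnits : (-1 : ℤ_[2]ˣ) ≠ 1 := by
  intro h
  have h' := congrArg (fun u : ℤ_[2]ˣ ↦ (u : ℤ_[2])) h
  simp only [Units.val_neg, Units.val_one] at h'
  norm_num at h'

/-- **Case (B2) ⟹ (B1), generic line.** `κ` a `ℤ₂`-line with topological generator `γ`, `U_m = κ.layerSubgroup m`, `m ≥ 1`, and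
`v̄` UNDECOMPOSED in `K_m` in the sense `∃ τ ∈ D_v̄, τ⁻¹ γ ∈ U_m` (so `D_v̄ · U_m = Γ_K`, `Γ_K / U_m = ⟨γ⟩` cyclic). If a sign character
`ε : Γ_K →* ℤˣ` is trivial on `U_m ⊓ D_v̄` but NOT on `D_v̄`, then on `D_v̄` it has the same kernel as the quadratic character `χ` of the line
(both are the unique order-two character of the cyclic group `D_v̄ / (D_v̄ ⊓ U_m)`). [cite: Washington1997, §13.1] [cite: NeukirchANT1999, Ch. I §9 Prop. (9.6)] -/
theorem sign_eq_one_iff_signChar_eq_one_on_decomp_of_mem {vbar : HeightOneSpectrum (𝓞 K)} (κ : ZpExtension K 2) {γ : absoluteGaloisGroup K}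
    (hγ : κ.IsTopGenerator γ) {m : ℕ} (hm : 1 ≤ m) {τ : absoluteGaloisGroup K} (hτD : τ ∈ decomp (K := K) vbar)
    (hτU : τ⁻¹ * γ ∈ κ.layerSubgroup m) (ε : absoluteGaloisGroup K →* ℤˣ)
    (hεU : ∀ u ∈ κ.layerSubgroup m, u ∈ decomp (K := K) vbar → ε u = 1) (hε : ∃ σ ∈ decomp (K := K) vbar, ε σ ≠ 1)
    (χ : absoluteGaloisGroup K →ₜ* ℤ_[2]ˣ) (hχv : ∀ σ, χ σ = 1 ∨ χ σ = -1) (hχker : ∀ σ, κ σ = 1 → χ σ = 1)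
    (hχgen : ∀ γ', κ.IsTopGenerator γ' → χ γ' = -1) :
    ∀ σ ∈ decomp (K := K) vbar, ε σ = 1 ↔ χ σ = 1 := by
  haveI : Fact (Nat.Prime 2) := ⟨Nat.prime_two⟩
  haveI hUn : (κ.layerSubgroup m).Normal := inferInstance
  -- `D_v̄ ⊆ ⋃ⱼ τ^j U_m`
  have hgen : ∀ σ ∈ decomp (K := K) vbar, ∃ j : ℕ, (τ ^ j)⁻¹ * σ ∈ κ.layerSubgroup m := by
    intro σ _
    obtain ⟨j, hj⟩ := exists_pow_inv_mul_mem_layerSubgroup κ hγ m σ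
    have hq : (QuotientGroup.mk τ : absoluteGaloisGroup K ⧸ κ.layerSubgroup m) = QuotientGroup.mk γ :=
      QuotientGroup.eq.mpr hτU
    have hqj : (QuotientGroup.mk (τ ^ j) : absoluteGaloisGroup K ⧸ κ.layerSubgroup m) = QuotientGroup.mk (γ ^ j) := by
      rw [QuotientGroup.mk_pow, QuotientGroup.mk_pow, hq]
    have hmem : (τ ^ j)⁻¹ * γ ^ j ∈ κ.layerSubgroup m := QuotientGroup.eq.mp hqj
    have : (τ ^ j)⁻¹ * σ = ((τ ^ j)⁻¹ * γ ^ j) * ((γ ^ j)⁻¹ * σ) := by group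
    refine ⟨j, ?_⟩
    rw [this]
    exact Subgroup.mul_mem _ hmem hj
  -- `χ` is trivial on `U_m` (`m ≥ 1`) and `χ τ = χ γ = -1`
  have hχ2 : ∀ σ, χ.toMonoidHom σ ^ 2 = 1 := fun σ ↦ by
    change χ σ ^ 2 = 1
    rcases hχv σ with h | h <;> rw [h]
    · rw [one_pow]
    · rw [neg_one_sq]
  have hχU : ∀ u ∈ κ.layerSubgroup m, χ.toMonoidHom u = 1 := fun u hu ↦
    apply_eq_one_of_mem_layerSubgroup_one κ χ.toMonoidHom hχ2 hχker (κ.layerSubgroup_antitone hm hu)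
  have hχτ : χ.toMonoidHom τ ≠ 1 := by
    change χ τ ≠ 1
    have h1 : χ (τ⁻¹ * γ) = 1 := hχU _ hτU
    rw [map_mul, map_inv, inv_mul_eq_one] at h1
    rw [h1, hχgen γ hγ]
    exact neg_one_ne_one_padicIntUnits
  have hχτ2 : χ.toMonoidHom (τ ^ 2) = 1 := by rw [map_pow]; exact hχ2 τ
  intro σ hσ
  exact apply_eq_one_iff_of_cyclic_mod (κ.layerSubgroup m) (decomp (K := K) vbar) hτD hgen ε hεU hε χ.toMonoidHom hχU hχτ hχτ2 σ hσ

/-- **Case (B2) ⟹ (B1) on the `v̄`-LINE** (`κ₂` unramified outside `v̄`, odd class number: `v̄` is TOTALLY RAMIFIED in the line, so a generator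
`τ ∈ I_{𝔓₀} ≤ D_v̄` of `Γ_K / U_m` exists, -w3 g14 `NormAtVbar.forall_exists_inertia_mul_mem_galFixing_layer`). [cite: Washington1997, §13.1]
[cite: NeukirchANT1999, Ch. I §9 Prop. (9.6)] -/
theorem sign_eq_one_iff_signChar_eq_one_on_decomp (hK : IsImaginaryQuadratic K) (h2K : ¬ 2 ∣ NumberField.classNumber K)
    {vbar : HeightOneSpectrum (𝓞 K)} (κ₂ : ZpExtension K 2) (hκ₂ : κ₂.IsUnramifiedOutside vbar) {γ₂ : absoluteGaloisGroup K}
    (hγ₂ : κ₂.IsTopGenerator γ₂) {m : ℕ} (hm : 1 ≤ m) (ε : absoluteGaloisGroup K →* ℤˣ)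
    (hεU : ∀ u ∈ κ₂.layerSubgroup m, u ∈ decomp (K := K) vbar → ε u = 1) (hε : ∃ σ ∈ decomp (K := K) vbar, ε σ ≠ 1)
    (χ : absoluteGaloisGroup K →ₜ* ℤ_[2]ˣ) (hχv : ∀ σ, χ σ = 1 ∨ χ σ = -1) (hχker : ∀ σ, κ₂ σ = 1 → χ σ = 1)
    (hχgen : ∀ γ, κ₂.IsTopGenerator γ → χ γ = -1) :
    ∀ σ ∈ decomp (K := K) vbar, ε σ = 1 ↔ χ σ = 1 := by
  haveI : Fact (Nat.Prime 2) := ⟨Nat.prime_two⟩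
  obtain ⟨τ, hτI, hτU⟩ := NormAtVbar.forall_exists_inertia_mul_mem_galFixing_layer hK h2K hκ₂ m (adicCompletionPrime K vbar)
    (adicCompletionPrime_mem_primesAbove K vbar) γ₂
  rw [Literature.NumberTheory.GaloisCohomology.galFixing_layer K κ₂ m] at hτU
  have hτD : τ ∈ decomp (K := K) vbar := by
    have h := Ideal.inertia_le_decompositionSubgroup (absoluteGaloisGroup K) _ hτI
    rw [decompositionSubgroup_adicCompletionPrime_eq_range] at h
    exact h
  exact sign_eq_one_iff_signChar_eq_one_on_decomp_of_mem κ₂ hγ₂ hm hτD hτU ε hεU hε χ hχv hχker hχgen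

/-- **Case (B2) ⟹ (B1) on the `v`-LINE of a DA7 frame** (`disc K = −7`, `κ₁` unramified outside `v`: `v̄` is UNDECOMPOSED in the line,
cf2c-w8 g4 `LinePin.exists_mem_decomp_vbar_apply_eq_of_discr` gives `τ ∈ D_v̄` with `κ₁ τ = κ₁ γ₁`). [cite: Washington1997, §13.1]
[cite: NeukirchANT1999, Ch. II §5] -/
theorem sign_eq_one_iff_signChar_eq_one_on_decomp_vLine (hK : IsImaginaryQuadratic K) (hdisc : NumberField.discr K = -7)
    {v vbar : HeightOneSpectrum (𝓞 K)} (hv : ((2 : ℕ) : 𝓞 K) ∈ v.asIdeal) (hvbar : ((2 : ℕ) : 𝓞 K) ∈ vbar.asIdeal) (hne : vbar ≠ v)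
    (κ₁ : ZpExtension K 2) (hκ₁ : κ₁.IsUnramifiedOutside v) {γ₁ : absoluteGaloisGroup K} (hγ₁ : κ₁.IsTopGenerator γ₁) {m : ℕ} (hm : 1 ≤ m)
    (ε : absoluteGaloisGroup K →* ℤˣ) (hεU : ∀ u ∈ κ₁.layerSubgroup m, u ∈ decomp (K := K) vbar → ε u = 1)
    (hε : ∃ σ ∈ decomp (K := K) vbar, ε σ ≠ 1)
    (χ : absoluteGaloisGroup K →ₜ* ℤ_[2]ˣ) (hχv : ∀ σ, χ σ = 1 ∨ χ σ = -1) (hχker : ∀ σ, κ₁ σ = 1 → χ σ = 1)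
    (hχgen : ∀ γ, κ₁.IsTopGenerator γ → χ γ = -1) :
    ∀ σ ∈ decomp (K := K) vbar, ε σ = 1 ↔ χ σ = 1 := by
  haveI : Fact (Nat.Prime 2) := ⟨Nat.prime_two⟩
  obtain ⟨τ, hτD, hτ⟩ := LinePin.exists_mem_decomp_vbar_apply_eq_of_discr hK hdisc hv hvbar hne κ₁ hκ₁ hγ₁
  have hτU : τ⁻¹ * γ₁ ∈ κ₁.layerSubgroup m := by
    apply κ₁.kerSubgroup_le_layerSubgroup m
    rw [ZpExtension.mem_kerSubgroup, map_mul, map_inv, hτ, inv_mul_cancel]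
  exact sign_eq_one_iff_signChar_eq_one_on_decomp_of_mem κ₁ hγ₁ hm hτD hτU ε hεU hε χ hχv hχker hχgen

/-! ## §4. Case (a): a sign non-trivial on `U ⊓ D_𝔓₀` is non-trivial on `U ⊓ D_𝔓` for every prime `𝔓 ∣ v̄` of `F′` -/

/-- **Case (a) of the closer.** If the sign `ε` is non-trivial at some `s₀ ∈ U ⊓ D_v̄` (`U = Gal(K̄/F)` normal, `D_v̄` the decomposition group of
the chosen prime `𝔓₀ ∣ v̄`), then above EVERY place `w′ ∣ v̄` of `F′` there is a prime `𝔓 = g • 𝔓₀` stabilised by the conjugate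
`s = g s₀ g⁻¹ ∈ U` with `ε s = ε s₀ ≠ 1` — the right disjunct of the twisted `v̄`-reading (p705557 / p706910 / p710454).
[cite: NeukirchANT1999, Ch. I §9 Prop. (9.1), (9.6)] -/
theorem forall_exists_stabilizer_sign_ne_one (F F' : IntermediateField K (AlgebraicClosure K)) [NumberField F']
    [(galFixing K F).Normal] (ε : absoluteGaloisGroup K →* ℤˣ) {vbar : HeightOneSpectrum (𝓞 K)}
    (h : ∃ s ∈ galFixing K F, s ∈ decomp (K := K) vbar ∧ ε s ≠ 1) (w' : vbar.Extension (𝓞 F')) :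
    ∃ 𝔓 : Ideal (absIntegers (𝓞 K) K),
      𝔓.comap (ringOfIntegersToIntegralClosure (k := K) (Ω := AlgebraicClosure K) F') = w'.1.asIdeal ∧
      ∃ s ∈ galFixing K F, ε s ≠ 1 ∧ s • 𝔓 = 𝔓 := by
  obtain ⟨s₀, hs₀U, hs₀D, hs₀ε⟩ := h
  obtain ⟨𝔓, h𝔓prime, h𝔓w⟩ := KummerU.exists_prime_absIntegers_comap_eq (K := K) F' w'.1
  haveI := h𝔓prime
  -- `𝔓 ∣ v̄`
  have h𝔓 : 𝔓 ∈ vbar.primesAbove := by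
    have hunder := KummerU.comap_algebraMap_eq_under_of_comap_eq F' h𝔓w
    have hmem : 𝔓 ∈ (w'.1.under (𝓞 K)).primesAbove := HeightOneSpectrum.mem_primesAbove_iff.2 ⟨h𝔓prime, ⟨hunder.symm⟩⟩
    rwa [w'.2] at hmem
  -- `𝔓 = g • 𝔓₀`
  obtain ⟨g, hg⟩ := HeightOneSpectrum.exists_smul_eq_of_mem_primesAbove_holds (K := K) (v := vbar)
    (adicCompletionPrime_mem_primesAbove K vbar) h𝔓
  have hs₀P : s₀ ∈ (adicCompletionPrime K vbar).decompositionSubgroup (absoluteGaloisGroup K) := by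
    rw [decompositionSubgroup_adicCompletionPrime_eq_range]; exact hs₀D
  refine ⟨𝔓, h𝔓w, g * s₀ * g⁻¹, Subgroup.Normal.conj_mem inferInstance s₀ hs₀U g, ?_, ?_⟩
  · rwa [map_mul, map_mul, map_inv, mul_inv_cancel_comm]
  · have hmem : g * s₀ * g⁻¹ ∈ 𝔓.decompositionSubgroup (absoluteGaloisGroup K) := by
      rw [← hg, Ideal.decompositionSubgroup_smul]
      exact Subgroup.smul_mem_pointwise_smul _ _ _ hs₀P
    exact (Ideal.mem_decompositionSubgroup_iff).mp hmem


/-! ## §5. The re-twist `θ₀ = θ ⊗ χ_κ`: same character on `U_m`, sign trivial on `D_v̄` -/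

omit [NumberField K] in
/-- **Twisting a quadratic framed character by a `{±1}`-valued continuous character.** For `θ` with `θ² = 1` and `χ : Γ_K →ₜ* ℤ₂ˣ` with values
`±1` there is a framed `θ₀` (namely `θ ⊗ (e_𝒪 ∘ χ)`) with `θ₀² = 1` and `unitChar θ₀ = χ · unitChar θ`. [cite: KellerYin2024, §1.1] -/
theorem exists_twist_by_signChar (θ : FramedGaloisRep K (padicCoeffIntegers (∅ : Set (PadicAlgCl 2))) 1)
    (hθ2 : ∀ σ : absoluteGaloisGroup K, θ σ ^ 2 = 1) (χ : absoluteGaloisGroup K →ₜ* ℤ_[2]ˣ) (hχpm : ∀ σ, χ σ = 1 ∨ χ σ = -1) :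
    haveI : Fact (Nat.Prime 2) := ⟨Nat.prime_two⟩
    ∃ θ₀ : FramedGaloisRep K (padicCoeffIntegers (∅ : Set (PadicAlgCl 2))) 1,
      (∀ σ : absoluteGaloisGroup K, θ₀ σ ^ 2 = 1) ∧ ∀ σ, unitChar θ₀ σ = χ σ * unitChar θ σ := by
  haveI : Fact (Nat.Prime 2) := ⟨Nat.prime_two⟩
  have hχsq : ∀ σ, χ σ * χ σ = 1 := fun σ ↦ by
    rcases hχpm σ with h | h <;> rw [h] <;> simp
  obtain ⟨χ', hχ'⟩ : ∃ χ' : absoluteGaloisGroup K →ₜ* (padicCoeffIntegers (∅ : Set (PadicAlgCl 2)))ˣ,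
      ∀ σ, ((χ' σ : (padicCoeffIntegers (∅ : Set (PadicAlgCl 2)))ˣ) : padicCoeffIntegers (∅ : Set (PadicAlgCl 2))) =
        padicIntEquivCoeffIntegersEmpty 2 ((χ σ : ℤ_[2]ˣ) : ℤ_[2]) :=
    ⟨(⟨Units.map (padicIntEquivCoeffIntegersEmpty 2).toRingHom.toMonoidHom,
        Continuous.units_map _ (continuous_padicIntEquivCoeffIntegersEmpty 2)⟩ :
          ℤ_[2]ˣ →ₜ* (padicCoeffIntegers (∅ : Set (PadicAlgCl 2)))ˣ).comp χ, fun _ ↦ rfl⟩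
  have hχ'sq : ∀ σ, χ' σ ^ 2 = 1 := fun σ ↦ by
    apply Units.ext
    apply (padicIntEquivCoeffIntegersEmpty 2).symm.injective
    rw [Units.val_pow_eq_pow_val, map_pow, hχ', RingEquiv.symm_apply_apply, ← Units.val_pow_eq_pow_val, sq, hχsq,
      Units.val_one, Units.val_one, map_one]
  refine ⟨FramedRep.twist θ χ', fun σ ↦ ?_, fun σ ↦ XRegPinned.unitChar_twist θ χ' χ hχ' σ⟩
  rw [FramedRep.twist_apply, (FramedRep.scalar_commute (χ' σ) (θ σ)).mul_pow, hθ2, mul_one, ← map_pow, hχ'sq, map_one]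

/-- **THE RE-TWIST, generic line.** With the data of `sign_eq_one_iff_signChar_eq_one_on_decomp_of_mem` for the sign `ε` of the quadratic
framed character `θ` (`ε σ = 1 ↔ unitChar θ σ = 1`): there is a quadratic framed `θ₀` (`= θ ⊗ χ_κ`) which AGREES WITH `θ` ON `U_m`
(`m ≥ 1`; in particular on `ker κ`) and whose sign is TRIVIAL ON `D_v̄` (every `ε₀` with `ε₀ σ = 1 ↔ unitChar θ₀ σ = 1`) — case (B2) ⟹ (B1).
[cite: Washington1997, §13.1] [cite: GreenbergLNM1716, §4 p. 107] -/
theorem exists_retwist_agree_on_layer_sign_trivial_on_decomp {vbar : HeightOneSpectrum (𝓞 K)} (κ : ZpExtension K 2)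
    {γ : absoluteGaloisGroup K} (hγ : κ.IsTopGenerator γ) {m : ℕ} (hm : 1 ≤ m) {τ : absoluteGaloisGroup K}
    (hτD : τ ∈ decomp (K := K) vbar) (hτU : τ⁻¹ * γ ∈ κ.layerSubgroup m)
    (θ : FramedGaloisRep K (padicCoeffIntegers (∅ : Set (PadicAlgCl 2))) 1) (hθ2 : ∀ σ : absoluteGaloisGroup K, θ σ ^ 2 = 1)
    (ε : absoluteGaloisGroup K →* ℤˣ)
    (hε : haveI : Fact (Nat.Prime 2) := ⟨Nat.prime_two⟩; ∀ σ, ε σ = 1 ↔ unitChar θ σ = 1)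
    (hεU : ∀ u ∈ κ.layerSubgroup m, u ∈ decomp (K := K) vbar → ε u = 1) (hεD : ∃ σ ∈ decomp (K := K) vbar, ε σ ≠ 1) :
    haveI : Fact (Nat.Prime 2) := ⟨Nat.prime_two⟩
    ∃ θ₀ : FramedGaloisRep K (padicCoeffIntegers (∅ : Set (PadicAlgCl 2))) 1,
      (∀ σ : absoluteGaloisGroup K, θ₀ σ ^ 2 = 1) ∧
      (∀ u ∈ κ.layerSubgroup m, unitChar θ₀ u = unitChar θ u) ∧
      (∀ u ∈ κ.kerSubgroup, unitChar θ₀ u = unitChar θ u) ∧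
      ∀ ε₀ : absoluteGaloisGroup K →* ℤˣ, (∀ σ, ε₀ σ = 1 ↔ unitChar θ₀ σ = 1) → ∀ σ ∈ decomp (K := K) vbar, ε₀ σ = 1 := by
  haveI : Fact (Nat.Prime 2) := ⟨Nat.prime_two⟩
  obtain ⟨χ, hχpm, hχker, hχgen⟩ := XRegPinned.exists_signChar κ
  obtain ⟨θ₀, hθ₀2, hu₀⟩ := exists_twist_by_signChar θ hθ2 χ hχpm
  have hχ2 : ∀ σ, χ.toMonoidHom σ ^ 2 = 1 := fun σ ↦ by
    change χ σ ^ 2 = 1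
    rcases hχpm σ with h | h <;> rw [h]
    · rw [one_pow]
    · rw [neg_one_sq]
  have hχU1 : ∀ u ∈ κ.layerSubgroup 1, χ u = 1 := fun u hu ↦ apply_eq_one_of_mem_layerSubgroup_one κ χ.toMonoidHom hχ2 hχker hu
  have hD := sign_eq_one_iff_signChar_eq_one_on_decomp_of_mem κ hγ hm hτD hτU ε hεU hεD χ hχpm hχker hχgen
  refine ⟨θ₀, hθ₀2, fun u hu ↦ ?_, fun u hu ↦ ?_, fun ε₀ hε₀ σ hσ ↦ ?_⟩
  · rw [hu₀, hχU1 u (κ.layerSubgroup_antitone hm hu), one_mul]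
  · rw [hu₀, hχker u (ZpExtension.mem_kerSubgroup.mp hu), one_mul]
  · rw [hε₀, hu₀]
    have h1 := hD σ hσ
    rw [hε] at h1
    -- `χ σ = 1 ↔ unitChar θ σ = 1`, both `±1`-valued ⟹ product is `1`
    rcases hχpm σ with h | h
    · rw [h, one_mul]; exact h1.mpr h
    · rcases KummerUDict.unitChar_eq_one_or_eq_neg_one θ hθ2 σ with h' | h'
      · exact absurd (h1.mp h') (by rw [h]; exact neg_one_ne_one_padicIntUnits)
      · rw [h, h', neg_mul_neg, one_mul]

end Summit.BirchSwinnertonDyer.BirchSwinnertonDyer.Theorems.PrintCf2.XRegClose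

end
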